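import Summits.Ventures.PercRepro.RankLevelSetDepCountGen
import Summits.Ventures.PercRepro.RankLevelSetLevelFive
import Summits.Ventures.PercRepro.RankLevelSetDepCountGiantB2
import Summits.Ventures.PercRepro.RankLevelSetLevelFiveArithGiantA
import Summits.Ventures.PercRepro.RankLevelSetLevelFiveArithGiantB
import Summits.Ventures.PercRepro.RankLevelSetLevelFiveArithGiantC
import Summits.Ventures.PercRepro.RankLevelSetLevelFiveMult
import Summits.Ventures.PercRepro.RankLevelSetLevelSplitAll
import Summits.Ventures.PercRepro.S1TriangleCount
import Summits.Ventures.PercRepro.S1FourCircuitCount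
import Summits.Ventures.PercRepro.RankLevelSetPlaneTenPrime
import Summits.Ventures.PercRepro.RankLevelSetCoreFiveNineteen
import Summits.Ventures.PercRepro.RankLevelSetCorankFiveCounts
import Summits.Ventures.PercRepro.S2FiveWindow

/-!
# PercRepro — THEOREM C₅ WITH THE UNIQUE GIANT FLAT: C-025 AT LEVEL `5` FOR EVERY FINITE MATROID AND EVERY `p ≥ 55`
(p7, gen 0; sub-claim S2)

`proofs/SUBCLAIM-S2-p7.md` R3′. p8's UNIQUE-GIANT-FLAT count (RankLevelSetDepCountGiantB2, `ncard_eRk_eq_ncard_le_le_giant`):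
nullity is supermodular, two distinct rank-`q` flats meet in a set of rank `≤ q − 1` and nullity `≤ ν_∩`, so at most ONE
rank-`q` flat has nullity `≥ ν₁ := (d + ν_∩)/2 + 1` — the big-closure pairs split into the MID class (closures of
`≤ q + ν₁ − 1` points, fibre over `≤ ν₁ − 2` free points) and the GIANT class (pairs inside the one giant flat, counted by
its size), all with night-1's multiplicity weights `1/(j + 1)`. At `q = 5` on the `e`-free core `ν_∩ = 6` (rank-`≤ 4`
sets have `≤ r + 6` points: `10 / 6 / 3 / 1` at ranks `4 / 3 / 2 / 1`), the flat bounds are the capped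
`min 19 (5 + d)` / `min 10 (4 + d)`, the circuit bounds Lemma T / T4 / the nullity bounds, and the polynomial
inequalities `level_five_poly_giant` (`p ≥ 54`, coranks `6 … 25`, RankLevelSetLevelFiveArithGiantA/B/C) close the core;
coranks `≥ 26` by `c025_core_five_nineteen` (`p ≥ 27`).

* **`level_five_poly_giant`** — the dispatcher of the twenty polynomial inequalities;
* `sum_Icc_three_six_q` — the `ℚ` form of the four-term sum; `sixteen_mul_sum_choose_le_twentyone` — the binomial tail
  at `21` from `n = 55` (the cells with `p + d < 68` need it in place of night-1's tail at `27`);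
* **`hinter_five`** — the intersection-nullity bound `ν_∩ = 6` of the `e`-free core at level `5`;
* **`c025_core_five_bounded_corank_giant`** — the `e`-free core at level `5`, corank `6 ≤ d ≤ 25`, rank `p ≥ 54`;
* **`c025_five_of_four_giant`** — level `4` for all `p ≥ 54` implies level `5` for every `p ≥ 55`;
* **`c025_five_large_giant`** — UNCONDITIONAL over the landed tree: every finite matroid satisfies C-025 at level `5`
  for every `p ≥ 55` (level `4` from the split row, `p ≥ 43`); `c025_five_large_giant'` is the set-builder spelling of
  `C025` at `(p, 5)`.
Axioms: standard.
-/

open scoped Matroid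

namespace PercRepro

/-- **`(P_d)` at level `5`, multiplicity-weighted split count (cap, `f(5) ≤ 19`, T, T4), every corank `6 ≤ d ≤ 25`,
every `p ≥ 54`, in `ℚ`.** -/
theorem level_five_poly_giant (d : ℕ) (hd1 : 6 ≤ d) (hd2 : d ≤ 25) (p : ℕ) (hp : 54 ≤ p) :
    8 * (((p + d).choose 5 : ℚ) +
      (∑ j ∈ Finset.range (d - 5), (Nat.choose (min 5 (d - 1)) j : ℚ) / (j + 1)) *
        ((d * (d + 1) / 2 * (p + d).choose 3 + d * (d + 1) * (d + 2) / 3 * (p + d).choose 2 + (d + 4).choose 5 * (p + d) + (d + 5).choose 6 : ℕ) : ℚ) +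
      (∑ j ∈ Finset.range (d - 5), (Nat.choose (min 13 ((d + 6) / 2 + 1 - 2)) j : ℚ) / (j + 1)) *
        ((d * (d + 1) / 2 * (6 * d).choose 3 + d * (d + 1) * (d + 2) / 3 * (6 * d).choose 2 + (d + 4).choose 5 * (6 * d) + (d + 5).choose 6 : ℕ) : ℚ) +
      (∑ j ∈ Finset.range (d - 5), (Nat.choose (min 19 (5 + d) - 6) j : ℚ) / (j + 1)) *
        ((d * (d + 1) / 2 * (min 19 (5 + d)).choose 3 + d * (d + 1) * (d + 2) / 3 * (min 19 (5 + d)).choose 2 + (d + 4).choose 5 * (min 19 (5 + d)) + (d + 5).choose 6 : ℕ) : ℚ)) ≤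
      7 * 2 ^ (d - 5) * ((p + 5).choose 5 : ℚ) := by
  interval_cases d
  · exact level_five_poly_giant_6 p hp
  · exact level_five_poly_giant_7 p hp
  · exact level_five_poly_giant_8 p hp
  · exact level_five_poly_giant_9 p hp
  · exact level_five_poly_giant_10 p hp
  · exact level_five_poly_giant_11 p hp
  · exact level_five_poly_giant_12 p hp
  · exact level_five_poly_giant_13 p hp
  · exact level_five_poly_giant_14 p hp
  · exact level_five_poly_giant_15 p hp
  · exact level_five_poly_giant_16 p hp
  · exact level_five_poly_giant_17 p hp
  · exact level_five_poly_giant_18 p hp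
  · exact level_five_poly_giant_19 p hp
  · exact level_five_poly_giant_20 p hp
  · exact level_five_poly_giant_21 p hp
  · exact level_five_poly_giant_22 p hp
  · exact level_five_poly_giant_23 p hp
  · exact level_five_poly_giant_24 p hp
  · exact level_five_poly_giant_25 p hp

namespace ThmN

open Set

variable {α : Type}

/-- The four-term form of a sum over `Icc 3 6` in `ℚ` (the `ℚ` twin of `sum_Icc_three_six`). -/
theorem sum_Icc_three_six_q (g : ℕ → ℚ) : ∑ k ∈ Finset.Icc 3 6, g k = g 3 + g 4 + g 5 + g 6 := by
  rw [show (6 : ℕ) = 5 + 1 from rfl, Finset.sum_Icc_succ_top (by norm_num),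
    show (5 : ℕ) = 4 + 1 from rfl, Finset.sum_Icc_succ_top (by norm_num),
    show (4 : ℕ) = 3 + 1 from rfl, Finset.sum_Icc_succ_top (by norm_num), Finset.Icc_self,
    Finset.sum_singleton]

/-- **The binomial tail at `21`**: `16·Σ_{j ≤ 21} C(n, j) ≤ 2^n` for every `n ≥ 55` (the `55` is exact: `54` fails). -/
theorem sixteen_mul_sum_choose_le_twentyone (n : ℕ) (hn : 55 ≤ n) :
    16 * ∑ j ∈ Finset.range 22, n.choose j ≤ 2 ^ n := by
  induction n, hn using Nat.le_induction with
  | base =>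
    simp only [Finset.sum_range_succ]
    norm_num [Nat.choose]
  | succ n hn ih =>
    have h : ∑ j ∈ Finset.range 22, (n + 1).choose j ≤ 2 * ∑ j ∈ Finset.range 22, n.choose j :=
      sum_choose_succ_le_two_mul n 21
    rw [pow_succ]
    omega

/-- **The intersection-nullity bound of the `e`-free core at level `5`**: a set of rank `≤ 4` has at most `r + 6` points
(`10 / 6 / 3 / 1 / 0` points at ranks `4 / 3 / 2 / 1 / 0`). -/
theorem hinter_five (M : Matroid α) [M.Finite]
    (hfree : ∀ e ∈ M.E, ∃ A ⊆ M.E \ {e}, e ∉ M.closure A ∧ e ∉ M.closure ((M.E \ {e}) \ A)) :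
    ∀ X ⊆ M.E, M.eRk X ≤ ((5 - 1 : ℕ) : ℕ∞) → (X.ncard : ℕ∞) ≤ M.eRk X + (6 : ℕ) := by
  intro X hX hr
  obtain ⟨k, hk⟩ := Matroid.exists_eRk_eq_nat (M := M) hX
  rw [hk] at hr ⊢
  have hk4 : k ≤ 4 := by exact_mod_cast hr
  have hL0 : ∀ e ∈ M.E, ¬ M.IsLoop e := not_isLoop_of_free M hfree
  have hcard : X.ncard ≤ k + 6 := by
    rcases Nat.lt_or_ge k 4 with h | h
    · have := ncard_add_one_le_two_pow_of_eRk_le M hL0 hfree k X hX (le_of_eq hk)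
      interval_cases k <;> omega
    · have hk' : k = 4 := by omega
      subst hk'
      have := ncard_le_ten_of_eRk_le_four_of_free M hfree hX (le_of_eq hk)
      omega
  exact_mod_cast hcard

/-- **The `e`-free core at level `5`, corank `6 ≤ d ≤ 25`, rank `p ≥ 54`** (the unique-giant-flat count with the
nullity cap, `f(5) ≤ 19`, Lemmas T and T4). -/
theorem c025_core_five_bounded_corank_giant (M : Matroid α) [M.Finite] (p d : ℕ) (hp : 54 ≤ p) (hd6 : 6 ≤ d)
    (hd25 : d ≤ 25) (hR : M.eRank = (p : ℕ∞)) (hn : M.E.ncard = p + d)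
    (hfree : ∀ e ∈ M.E, ∃ A ⊆ M.E \ {e}, e ∉ M.closure A ∧ e ∉ M.closure ((M.E \ {e}) \ A)) :
    RLS M p 5 := by
  classical
  have hEcard : M.ground_finite.toFinset.card = p + d := by
    rw [← Set.ncard_eq_toFinset_card _ M.ground_finite]; exact hn
  -- the core is simple: every circuit has `≥ 3` elements
  have hL0 : ∀ e ∈ M.E, ¬ M.IsLoop e := not_isLoop_of_free M hfree
  have hs : ∀ e ∈ M.E, ∀ f ∈ M.E, e ≠ f → M.eRk {e, f} = 2 := by
    intro e he f hf hef
    have h2 : (2 : ℕ∞) ≤ M.eRk {e, f} :=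
      two_le_eRk_of_two_le_ncard_of_free M hfree (pair_subset he hf) (by rw [ncard_pair hef])
    have h3 : M.eRk {e, f} ≤ 2 := by
      have := M.eRk_le_encard {e, f}
      rwa [encard_pair hef] at this
    exact le_antisymm h3 h2
  have hcirc : ∀ C, M.IsCircuit C → 3 ≤ C.encard := three_le_encard_of_circuit M hL0 hs
  have hd : M.E.encard = M.eRank + d := by
    rw [hR, ← M.ground_finite.cast_ncard_eq, hn]
    push_cast
    ring
  -- the capped flat bounds: rank-`≤ 5` sets have `≤ min 19 (5 + d)` points, rank-`≤ 4` sets `≤ min 10 (4 + d)`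
  have hflat : ∀ X ⊆ M.E, M.eRk X ≤ 5 → X.ncard ≤ min 19 (5 + d) := fun X hX hr =>
    le_min (ncard_le_nineteen_of_eRk_le_five_of_free M hfree hX hr)
      (ncard_le_add_of_eRk_le_of_encard_eq M hd hX hr)
  have hflat' : ∀ X ⊆ M.E, M.eRk X ≤ ((5 - 1 : ℕ) : ℕ∞) → X.ncard ≤ min 10 (4 + d) := fun X hX hr =>
    le_min (ncard_le_ten_of_eRk_le_four_of_free M hfree hX (by simpa using hr))
      (ncard_le_add_of_eRk_le_of_encard_eq M hd hX (by simpa using hr))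
  -- the circuit counts: Lemma T, Lemma T4, and the nullity bounds
  have hC1 : ∀ L ⊆ M.E, M.eRk L = 2 → L.ncard ≤ 3 :=
    fun L hL hr => ncard_le_three_of_eRk_two M hs hfree hL hr
  have hC1' : ∀ L ⊆ M.E, M.eRk L ≤ 2 → L.ncard ≤ 3 := fun L hL hr => by
    have := ncard_add_one_le_two_pow_of_eRk_le M hL0 hfree 2 L hL hr
    omega
  have hC2 : ∀ P ⊆ M.E, M.eRk P ≤ 3 → P.ncard ≤ 6 :=
    fun P hP hr => ncard_le_six_of_eRk_le_three_of_free M hfree hP hr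
  have hs3 : {C | M.IsCircuit C ∧ C.ncard = 3}.ncard ≤ d * (d + 1) / 2 := by
    have := S1.two_mul_ncard_triangles_le M hC1 hd
    unfold triangles at this
    omega
  have hs4 : {C | M.IsCircuit C ∧ C.ncard = 4}.ncard ≤ d * (d + 1) * (d + 2) / 3 := by
    have := S1.three_mul_ncard_four_circuits_le M hC1' hC2 hd
    omega
  have hs5 : {C | M.IsCircuit C ∧ C.ncard = 5}.ncard ≤ (d + 4).choose 5 :=
    Matroid.ncard_circuits_le_choose_of_encard M hd 4
  have hs6 : {C | M.IsCircuit C ∧ C.ncard = 6}.ncard ≤ (d + 5).choose 6 :=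
    Matroid.ncard_circuits_le_choose_of_encard M hd 5
  -- (U): p8's unique-giant-flat count in `ℚ`, then the circuit bounds
  set ν₁ : ℕ := (d + 6) / 2 + 1 with hν₁
  have hU0 := Matroid.ncard_eRk_eq_ncard_le_le_giant M 5 (min 19 (5 + d)) (min 10 (4 + d)) ν₁ 6 (by norm_num)
    hcirc hflat hflat' (hinter_five M hfree) hd (by omega)
  have hU1 := Matroid.topCount_le_ncard_compl (M := M) hR hd 5
  have hm1 : min (min 19 (5 + d) - 6) (ν₁ - 2) = min 13 ((d + 6) / 2 + 1 - 2) := by omega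
  have hm2 : min 10 (4 + d) - 5 = min 5 (d - 1) := by omega
  have hm3 : min (min 19 (5 + d)) (5 + d) = min 19 (5 + d) := by omega
  simp only [show (5 : ℕ) + 1 = 6 from rfl] at hU0
  rw [hn, sum_Icc_three_six_q, sum_Icc_three_six_q, sum_Icc_three_six_q, hm1, hm2, hm3,
    show d - 6 + 1 = d - 5 by omega] at hU0
  simp only [show (6 : ℕ) - 3 = 3 from rfl, show (6 : ℕ) - 4 = 2 from rfl,
    show (6 : ℕ) - 5 = 1 from rfl, show (6 : ℕ) - 6 = 0 from rfl, Nat.choose_one_right,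
    Nat.choose_zero_right] at hU0
  have hUq : (Matroid.topCount M p 5 : ℚ) ≤ ((p + d).choose 5 : ℚ) +
      (∑ j ∈ Finset.range (d - 5), (Nat.choose (min 5 (d - 1)) j : ℚ) / (j + 1)) *
        ((d * (d + 1) / 2 * (p + d).choose 3 + d * (d + 1) * (d + 2) / 3 * (p + d).choose 2 +
          (d + 4).choose 5 * (p + d) + (d + 5).choose 6 : ℕ) : ℚ) +
      (∑ j ∈ Finset.range (d - 5), (Nat.choose (min 13 ((d + 6) / 2 + 1 - 2)) j : ℚ) / (j + 1)) *
        ((d * (d + 1) / 2 * (6 * d).choose 3 + d * (d + 1) * (d + 2) / 3 * (6 * d).choose 2 +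
          (d + 4).choose 5 * (6 * d) + (d + 5).choose 6 : ℕ) : ℚ) +
      (∑ j ∈ Finset.range (d - 5), (Nat.choose (min 19 (5 + d) - 6) j : ℚ) / (j + 1)) *
        ((d * (d + 1) / 2 * (min 19 (5 + d)).choose 3 + d * (d + 1) * (d + 2) / 3 * (min 19 (5 + d)).choose 2 +
          (d + 4).choose 5 * (min 19 (5 + d)) + (d + 5).choose 6 : ℕ) : ℚ) := by
    have hU1q : (Matroid.topCount M p 5 : ℚ) ≤
        ({B : Set α | B ⊆ M.E ∧ M.eRk B = 5 ∧ B.ncard ≤ d}.ncard : ℚ) := by exact_mod_cast hU1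
    have hsm : {C | M.IsCircuit C ∧ C.ncard = 3}.ncard * (p + d).choose 3 +
        {C | M.IsCircuit C ∧ C.ncard = 4}.ncard * (p + d).choose 2 +
        {C | M.IsCircuit C ∧ C.ncard = 5}.ncard * (p + d) + {C | M.IsCircuit C ∧ C.ncard = 6}.ncard * 1 ≤
        d * (d + 1) / 2 * (p + d).choose 3 + d * (d + 1) * (d + 2) / 3 * (p + d).choose 2 +
          (d + 4).choose 5 * (p + d) + (d + 5).choose 6 := by
      have := hs6
      gcongr
      omega
    have hbg : {C | M.IsCircuit C ∧ C.ncard = 3}.ncard * (6 * d).choose 3 +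
        {C | M.IsCircuit C ∧ C.ncard = 4}.ncard * (6 * d).choose 2 +
        {C | M.IsCircuit C ∧ C.ncard = 5}.ncard * (6 * d) + {C | M.IsCircuit C ∧ C.ncard = 6}.ncard * 1 ≤
        d * (d + 1) / 2 * (6 * d).choose 3 + d * (d + 1) * (d + 2) / 3 * (6 * d).choose 2 +
          (d + 4).choose 5 * (6 * d) + (d + 5).choose 6 := by
      gcongr
      omega
    have hgg : {C | M.IsCircuit C ∧ C.ncard = 3}.ncard * (min 19 (5 + d)).choose 3 +
        {C | M.IsCircuit C ∧ C.ncard = 4}.ncard * (min 19 (5 + d)).choose 2 +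
        {C | M.IsCircuit C ∧ C.ncard = 5}.ncard * (min 19 (5 + d)) + {C | M.IsCircuit C ∧ C.ncard = 6}.ncard * 1 ≤
        d * (d + 1) / 2 * (min 19 (5 + d)).choose 3 + d * (d + 1) * (d + 2) / 3 * (min 19 (5 + d)).choose 2 +
          (d + 4).choose 5 * (min 19 (5 + d)) + (d + 5).choose 6 := by
      gcongr
      omega
    have hsmq : (({C | M.IsCircuit C ∧ C.ncard = 3}.ncard : ℚ) * ((p + d).choose 3 : ℚ) +
        ({C | M.IsCircuit C ∧ C.ncard = 4}.ncard : ℚ) * ((p + d).choose 2 : ℚ) +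
        ({C | M.IsCircuit C ∧ C.ncard = 5}.ncard : ℚ) * ((p + d : ℕ) : ℚ) +
        ({C | M.IsCircuit C ∧ C.ncard = 6}.ncard : ℚ) * ((1 : ℕ) : ℚ)) ≤
        ((d * (d + 1) / 2 * (p + d).choose 3 + d * (d + 1) * (d + 2) / 3 * (p + d).choose 2 +
          (d + 4).choose 5 * (p + d) + (d + 5).choose 6 : ℕ) : ℚ) := by exact_mod_cast hsm
    have hbgq : (({C | M.IsCircuit C ∧ C.ncard = 3}.ncard : ℚ) * ((6 * d).choose 3 : ℚ) +
        ({C | M.IsCircuit C ∧ C.ncard = 4}.ncard : ℚ) * ((6 * d).choose 2 : ℚ) +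
        ({C | M.IsCircuit C ∧ C.ncard = 5}.ncard : ℚ) * ((6 * d : ℕ) : ℚ) +
        ({C | M.IsCircuit C ∧ C.ncard = 6}.ncard : ℚ) * ((1 : ℕ) : ℚ)) ≤
        ((d * (d + 1) / 2 * (6 * d).choose 3 + d * (d + 1) * (d + 2) / 3 * (6 * d).choose 2 +
          (d + 4).choose 5 * (6 * d) + (d + 5).choose 6 : ℕ) : ℚ) := by exact_mod_cast hbg
    have hggq : (({C | M.IsCircuit C ∧ C.ncard = 3}.ncard : ℚ) * ((min 19 (5 + d)).choose 3 : ℚ) +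
        ({C | M.IsCircuit C ∧ C.ncard = 4}.ncard : ℚ) * ((min 19 (5 + d)).choose 2 : ℚ) +
        ({C | M.IsCircuit C ∧ C.ncard = 5}.ncard : ℚ) * ((min 19 (5 + d) : ℕ) : ℚ) +
        ({C | M.IsCircuit C ∧ C.ncard = 6}.ncard : ℚ) * ((1 : ℕ) : ℚ)) ≤
        ((d * (d + 1) / 2 * (min 19 (5 + d)).choose 3 + d * (d + 1) * (d + 2) / 3 * (min 19 (5 + d)).choose 2 +
          (d + 4).choose 5 * (min 19 (5 + d)) + (d + 5).choose 6 : ℕ) : ℚ) := by exact_mod_cast hgg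
    refine hU1q.trans (hU0.trans ?_)
    gcongr
  -- (Y)
  have hflat21 : ∀ X ⊆ M.E, M.eRk X ≤ 5 → X.ncard ≤ 21 :=
    fun X hX hr => ncard_le_twentyone_of_eRk_le_five_of_free M hfree hX hr
  have hY := Matroid.two_pow_le_midCount_add (M := M) p 5 hR
  have hA : {X : Set α | X ⊆ M.E ∧ M.eRk X ≤ 5}.ncard ≤ ∑ j ∈ Finset.range (21 + 1), (p + d).choose j := by
    calc {X : Set α | X ⊆ M.E ∧ M.eRk X ≤ 5}.ncard
        ≤ {X : Set α | X ⊆ (M.ground_finite.toFinset : Set α) ∧ X.ncard ≤ 21}.ncard := by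
          apply ncard_le_ncard
          · intro X hX
            exact ⟨by rw [Set.Finite.coe_toFinset]; exact hX.1, hflat21 X hX.1 hX.2⟩
          · exact (Finset.finite_toSet _).finite_subsets.subset (fun X hX => hX.1)
      _ ≤ ∑ j ∈ Finset.range (21 + 1), M.ground_finite.toFinset.card.choose j :=
          ncard_subsets_ncard_le _ 21
      _ = ∑ j ∈ Finset.range (21 + 1), (p + d).choose j := by rw [hEcard]
  have hB := Matroid.ncard_spanning_le (M := M) hd
  rw [hEcard] at hY hB
  -- the tails: `d ≤ 21` through the tail at `21` (`n ≥ 60 ≥ 55`), `d ≥ 22` through night-1's tail at `27` (`n ≥ 76`)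
  have hAB : 8 * ({X : Set α | X ⊆ M.E ∧ M.eRk X ≤ 5}.ncard +
      {X : Set α | X ⊆ M.E ∧ M.eRk X = M.eRank}.ncard) ≤ 2 ^ (p + d) := by
    rcases Nat.lt_or_ge d 22 with hd21 | hd22
    · have hT : 16 * ∑ j ∈ Finset.range 22, (p + d).choose j ≤ 2 ^ (p + d) :=
        sixteen_mul_sum_choose_le_twentyone (p + d) (by omega)
      have hB' : ∑ j ∈ Finset.range (d + 1), (p + d).choose j ≤ ∑ j ∈ Finset.range 22, (p + d).choose j :=
        Finset.sum_le_sum_of_subset_of_nonneg (Finset.range_mono (by omega)) (fun _ _ _ => Nat.zero_le _)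
      have hA' : ∑ j ∈ Finset.range (21 + 1), (p + d).choose j ≤ ∑ j ∈ Finset.range 22, (p + d).choose j :=
        le_of_eq rfl
      have h1 := hA.trans hA'
      have h2 := hB.trans hB'
      omega
    · have hT : 16 * ∑ j ∈ Finset.range 28, (p + d).choose j ≤ 2 ^ (p + d) :=
        sixteen_mul_sum_choose_le_twentyseven (p + d) (by omega)
      have hA' : ∑ j ∈ Finset.range (21 + 1), (p + d).choose j ≤ ∑ j ∈ Finset.range 28, (p + d).choose j :=
        Finset.sum_le_sum_of_subset_of_nonneg (Finset.range_mono (by norm_num)) (fun _ _ _ => Nat.zero_le _)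
      have hB' : ∑ j ∈ Finset.range (d + 1), (p + d).choose j ≤ ∑ j ∈ Finset.range 28, (p + d).choose j :=
        Finset.sum_le_sum_of_subset_of_nonneg (Finset.range_mono (by omega)) (fun _ _ _ => Nat.zero_le _)
      have h1 := hA.trans hA'
      have h2 := hB.trans hB'
      omega
  -- (Φ) and the polynomial inequality
  have hΦ := phiK_le_two_pow_div p 5
  rw [Nat.choose_symm_add] at hΦ
  have hpolyq := level_five_poly_giant d hd6 hd25 p hp
  rw [add_assoc, add_assoc] at hUq hpolyq
  -- assemble in `ℚ`
  rw [RLS_iff]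
  have hYq : (2 : ℚ) ^ (p + d) ≤ (Matroid.midCount M p 5 : ℚ) +
      ({X : Set α | X ⊆ M.E ∧ M.eRk X ≤ 5}.ncard : ℚ) +
      ({X : Set α | X ⊆ M.E ∧ M.eRk X = M.eRank}.ncard : ℚ) := by exact_mod_cast hY
  have hABq : 8 * (({X : Set α | X ⊆ M.E ∧ M.eRk X ≤ 5}.ncard : ℚ) +
      ({X : Set α | X ⊆ M.E ∧ M.eRk X = M.eRank}.ncard : ℚ)) ≤ 2 ^ (p + d) := by exact_mod_cast hAB
  have hU0 : (0 : ℚ) ≤ (Matroid.topCount M p 5 : ℚ) := Nat.cast_nonneg _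
  have hd5 : 5 ≤ d := by omega
  exact level_arith (p := p) (d := d) (n := p + d) (q := 5) rfl hd5 hΦ hU0 hUq hYq hABq hpolyq

/-- **THEOREM C₅, THE GIANT-FLAT CHAIN, GIVEN LEVEL `4`**: level `4` for all `p ≥ 54` implies level `5` for all
`p ≥ 55` (the S2 reduction `rls_five_of_four_of_core 54`: coranks `6 … 25` by the cells, `≥ 26` by
`c025_core_five_nineteen`). -/
theorem c025_five_of_four_giant (h4 : ∀ (M : Matroid α) [M.Finite] (p : ℕ), 54 ≤ p → RLS M p 4) :
    ∀ (M : Matroid α) [M.Finite] (p : ℕ), 55 ≤ p → RLS M p 5 := by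
  refine S2.rls_five_of_four_of_core 54 (by norm_num) h4 ?_
  intro M _ p hP hR hbig hfree
  rcases Nat.lt_or_ge M.E.ncard (p + 26) with h | h
  · exact c025_core_five_bounded_corank_giant M p (M.E.ncard - p) hP (by omega) (by omega) hR (by omega) hfree
  · exact c025_core_five_nineteen M p (by omega) hR (by omega) hfree

/-- **THEOREM C₅, THE GIANT-FLAT CHAIN, UNCONDITIONAL**: every finite matroid satisfies C-025 at level `5` for every
`p ≥ 55` (level `4` from THEOREM C₄ `c025_four_large`, `p ≥ 60`). -/
theorem c025_five_large_giant (M : Matroid α) [M.Finite] (p : ℕ) (hp : 55 ≤ p) : RLS M p 5 :=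
  c025_five_of_four_giant (fun M _ p hp => c025_four_large_split M p (by omega)) M p hp

/-- The level-`5` statement at `p ≥ 55` in the vocabulary of `C025`. -/
theorem c025_five_large_giant' (M : Matroid α) [M.Finite] (p : ℕ) (hp : 55 ≤ p) :
    phiK p 5 * ({A : Set α | A ⊆ M.E ∧ M.eRk A = (p : ℕ∞) ∧ M.eRk (M.E \ A) = (5 : ℕ∞)}.ncard : ℚ) ≤
      ({A : Set α | A ⊆ M.E ∧ (5 : ℕ∞) < M.eRk A ∧ M.eRk A < (p : ℕ∞)}.ncard : ℚ) :=
  c025_five_large_giant M p hp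

end ThmN

end PercRepro
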